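import Summits.PneNP.PneNP.Theorems.ChebyshevTracialDesignGammaDirectionFirstMomentBudget
import Summits.PneNP.PneNP.Theorems.ChebyshevTracialDesignGammaDirectionLevelBudgets
import Literature.Combinatorics.Optimization.ShellLawRelativeLevelSmoothness
import HarnessLib

/-!
# Cell pnp-psdrank, route `ChebyshevTracialDesign`: brick 130's THIRD input (iii), TURNKEY — Lq on `[n]` and brick 136 on the one-pinned family
# plugged into brick 137, windows and margins merged (crux `TracialDecayExp20`, stmt-PneNP-19878)

Brick 137b (eng g26). `…GammaDirectionFirstMomentBudget.sum_abs_fwdDiff_centredFirst_le_of_budgets` discharges hypothesis `(hBm)` of brick 130's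
`gammaProfile_newton_eval_zero_ge_of_centred` at a point from per-order budgets of two law families in Lq's output shape. This file supplies them:
* §1 `window_pin1` — the block-statistic window of the one-pinned family (one `HH` edge removed: `|H| ↦ |H|−2`, `N₀ ↦ N₀−1`, `s ↦ s−1`, `x ↦ x−2`)
  from the window at `x` with slack `+4` (real arithmetic); `centring_le_card` — the centring `m = E_1[n_A ∣ X=x]` is at most `a = |reps(vAA)|`;
* §2 **`sum_abs_fwdDiff_centredFirst_le`** — `(hBm)` with every budget plugged: the tree's `abs_fwdDiff_iter_shellLaw_le_of_hyps` (Lq) for the family on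
  `[n]` (types `(a₁+1,b,d)`, `N₀` edges, cut `2s+1`, point `x`) and brick 136 `levelBudget_pin1` for `Σ_v law_{[n]∖e_v}` (types `(a₁,b,d)`, `N₁ = N₀−1`,
  cut `2s₁+1 = 2s−1`, point `x₁ = x−2`, window slack `ε+4`); Lq's five real margins are stated ONCE at `(N₁, ε+4)` and moved to `(N₀, ε)` by brick 136's
  `lqMargins_mono`; the integer margins `βN₀+2D+1 ≤ b,d`, `8s ≤ (4+β)(N₀−2D)` at `N₀` and `βN₁+D ≤ s₁`, `D ≤ s₁`, `16D+16 ≤ N₁` imply the rest; two extra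
  hypotheses `q(N₀), q(N₁) ≤ ½` on Lq's ratio `q(N) = 4((1+η)(η+Q))²/(3β)` (asymptotically `→ 0`). Result:
  `ε_B = (m·(Γ(N₁)(2q(N₁) + 3D/s) + 2Γ(N₀)q(N₀)) + D(4/3)^D((2s/n + 4D/n)·a·e^{−(L−2D)²/(4N₁)} + m·e^{−(L−2D)²/(4N₀)})/LB)/√cV`, `Γ(N) = 1 + (4(√N+1)/3)Q(N)`.
* §3 (v2) `hcentre_condMean`: the canonical centring `m(x) = E_1[n_A ∣ X=x]` satisfies brick 130's `hcentre` at EVERY `x` (no side condition), and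
  `condMean_mem_Icc`: `0 ≤ m(x) ≤ a`.
What stays a hypothesis: the window floor `0 < LB ≤ law_{[n]}(2s+1,1;x)` (Literature `ShellLawWindowLowerBound`),
the variance floor (V) `cV·law ≤ A^m_1(x)` (lit `centredSq_section_ge_of_brackets`). WHAT THIS FILE DOES NOT DO: the numerics `ε_B ≤ ½` for `n ≥ n₀`, `(hA)`,
anything on `TracialDecayExp20` itself, psd rank of P_PM(K_n), or P vs NP. [cite: RollinRoss2010, §4.1 Thm 4.2] [cite: Rothvoss2017, §2 (PDF p. 6)]
[cite: Boole2009, Ch. II Art. 10 Ex. 3 eq. (8) (PDF pp. 34–35)]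
Stature: support/instrument (kernel lane, no defs, axioms standard). Supports stmt-PneNP-19878.
-/

set_option linter.dupNamespace false -- `Summit.PneNP.PneNP.…`: summit = sub-problem (D-0017)

noncomputable section

namespace Summit.PneNP.PneNP.Theorems.ChebyshevTracialDesignGammaDirectionFirstMomentTurnkey

open Finset Literature.Barriers.PneNP Literature.Combinatorics.Optimization
open Literature.Combinatorics.Optimization.ShellStep
open Summit.PneNP.PneNP.Theorems.ChebyshevTracialDesignGammaDirectionLevelBudgets (levelBudget_pin1 lqMargins_mono)
open Summit.PneNP.PneNP.Theorems.ChebyshevTracialDesignShellOperatorForm (shell_partner_nonempty)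
open Summit.PneNP.PneNP.Theorems.ChebyshevTracialDesignGammaDirectionFirstMomentBudget (sum_abs_fwdDiff_centredFirst_le_of_budgets)

variable {n : ℕ}

/-! ### §1 The one-pinned family's window; the centring is at most `a` -/


/-- **Window transfer for the one-pinned family** (real arithmetic): if `|x − (2s+1)P/(2N₀)| < ε` with `2 ≤ P ≤ 2N₀`, `2 ≤ N₀`, `1 ≤ s`,
`2s + 1 ≤ 2N₀`, then the shifted point of the one-pinned family (one `HH` edge removed: `P ↦ P−2`, `N₀ ↦ N₀−1`, `s ↦ s−1`, `x ↦ x−2`)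
satisfies `|(x−2) − (2s−1)(P−2)/(2(N₀−1))| < ε + 4`. [cite: Rothvoss2017, §2 (PDF p. 6)] -/
theorem window_pin1 {x s P N₀ ε : ℝ} (hN : 2 ≤ N₀) (hP0 : 2 ≤ P) (hP : P ≤ 2 * N₀) (hs1 : 1 ≤ s) (hs : 2 * s + 1 ≤ 2 * N₀)
    (hx : |x - (2 * s + 1) * P / (2 * N₀)| < ε) :
    |x - 2 - (2 * s - 1) * (P - 2) / (2 * (N₀ - 1))| < ε + 4 := by
  have hN1 : 0 < N₀ - 1 := by linarith
  have hN0 : 0 < N₀ := by linarith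
  -- `0 ≤ α − α' ≤ 1/(N₀−1)` for `α = P/(2N₀)`, `α' = (P−2)/(2(N₀−1))`
  have hα' : 0 ≤ (P - 2) / (2 * (N₀ - 1)) := div_nonneg (by linarith) (by linarith)
  have hα'1 : (P - 2) / (2 * (N₀ - 1)) ≤ 1 := by rw [div_le_one (by linarith)]; linarith
  have hdiff0 : 0 ≤ P / (2 * N₀) - (P - 2) / (2 * (N₀ - 1)) := by
    rw [div_sub_div _ _ (by linarith) (by linarith)]
    exact div_nonneg (by nlinarith) (by positivity)
  have hdiff1 : P / (2 * N₀) - (P - 2) / (2 * (N₀ - 1)) ≤ 1 / (N₀ - 1) := by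
    rw [div_sub_div _ _ (by linarith) (by linarith), div_le_div_iff₀ (by positivity) hN1]
    nlinarith
  -- the shift of the centres
  have hshift : |(2 * s + 1) * P / (2 * N₀) - 2 - (2 * s - 1) * (P - 2) / (2 * (N₀ - 1))| ≤ 4 := by
    have e : (2 * s + 1) * P / (2 * N₀) - 2 - (2 * s - 1) * (P - 2) / (2 * (N₀ - 1)) =
        (2 * s + 1) * (P / (2 * N₀) - (P - 2) / (2 * (N₀ - 1))) + 2 * ((P - 2) / (2 * (N₀ - 1))) - 2 := by ring
    rw [e, abs_le]
    have h3 : (2 * s + 1) * (P / (2 * N₀) - (P - 2) / (2 * (N₀ - 1))) ≤ (2 * N₀) * (1 / (N₀ - 1)) :=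
      mul_le_mul hs hdiff1 hdiff0 (by linarith)
    have h4 : (2 * N₀) * (1 / (N₀ - 1)) ≤ 4 := by
      rw [mul_one_div, div_le_iff₀ hN1]; linarith
    have h5 : 0 ≤ (2 * s + 1) * (P / (2 * N₀) - (P - 2) / (2 * (N₀ - 1))) := mul_nonneg (by linarith) hdiff0
    constructor <;> nlinarith
  have e2 : x - 2 - (2 * s - 1) * (P - 2) / (2 * (N₀ - 1)) =
      (x - (2 * s + 1) * P / (2 * N₀)) + ((2 * s + 1) * P / (2 * N₀) - 2 - (2 * s - 1) * (P - 2) / (2 * (N₀ - 1))) := by ring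
  rw [e2]
  exact lt_of_le_of_lt (abs_add_le _ _) (by linarith)

/-- **The centring is at most the number of `HH` edges**: if `B^m_1(x) = 0` (brick 130's `hcentre`) at a point of positive law, then
`m = E_1[n_A ∣ X = x] ≤ a = |reps(vAA)|` (`n_A ≤ a` pointwise). [cite: Rothvoss2017, §2 (PDF p. 6)] -/
theorem centring_le_card (M : PMatch n) (H : Finset (Fin n)) {t : ℕ} {x : ℤ} {m : ℝ}
    (hcentre : ((∑ U ∈ ((shell M.2.partner t 1).filter fun U => ((U ∩ H).card : ℤ) = x),
          (((((reps M.2.partner (vAA M.2.partner univ H)).filter fun v => v ∈ U ∧ M.2.partner v ∈ U).card : ℕ) : ℝ) - m)) /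
          ((shell M.2.partner t 1).card : ℝ)) = 0)
    (hpos : 0 < shellLaw M.2.partner univ H t 1 x) :
    m ≤ (reps M.2.partner (vAA M.2.partner univ H)).card := by
  have hsc : shellLaw M.2.partner univ H t 1 x =
      ((((shell M.2.partner t 1).filter fun U => ((U ∩ H).card : ℤ) = x).card : ℕ) : ℝ) / ((shell M.2.partner t 1).card : ℝ) := by
    rw [shellLaw, shellCount, shellIn_univ]
  rw [hsc] at hpos
  have hden : (0 : ℝ) < ((shell M.2.partner t 1).card : ℝ) := by
    rcases (Nat.cast_nonneg _ : (0 : ℝ) ≤ ((shell M.2.partner t 1).card : ℝ)).lt_or_eq with h | h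
    · exact h
    · rw [← h, div_zero] at hpos; exact absurd hpos (lt_irrefl 0)
  have hnum : (0 : ℝ) < ((((shell M.2.partner t 1).filter fun U => ((U ∩ H).card : ℤ) = x).card : ℕ) : ℝ) := by
    rcases div_pos_iff.1 hpos with ⟨h1, _⟩ | ⟨_, h2⟩
    · exact h1
    · linarith
  have hsum : ∑ U ∈ ((shell M.2.partner t 1).filter fun U => ((U ∩ H).card : ℤ) = x),
      ((((((reps M.2.partner (vAA M.2.partner univ H)).filter fun v => v ∈ U ∧ M.2.partner v ∈ U).card : ℕ) : ℝ) - m)) = 0 := by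
    rcases div_eq_zero_iff.1 hcentre with h | h
    · exact h
    · exact absurd h hden.ne'
  rw [sum_sub_distrib, sum_const, nsmul_eq_mul, sub_eq_zero] at hsum
  have hle : ∑ U ∈ ((shell M.2.partner t 1).filter fun U => ((U ∩ H).card : ℤ) = x),
      (((((reps M.2.partner (vAA M.2.partner univ H)).filter fun v => v ∈ U ∧ M.2.partner v ∈ U).card : ℕ) : ℝ)) ≤
      ∑ U ∈ ((shell M.2.partner t 1).filter fun U => ((U ∩ H).card : ℤ) = x), ((reps M.2.partner (vAA M.2.partner univ H)).card : ℝ) :=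
    sum_le_sum fun U _ => by exact_mod_cast card_filter_le _ _
  rw [sum_const, nsmul_eq_mul, hsum] at hle
  exact le_of_mul_le_mul_left hle hnum

/-! ### §2 The turnkey form -/

/-- **Brick 130's third input (iii) — TURNKEY.** For a perfect matching `M` on `Fin n`, `n = 2N₀`, a block `H` of type `(a₁+1, b, d)`, the cut
`2s+1` (`s = s₁+1`), the order `D ≤ s₁`, the point `x = x₁+2` in the block-statistic window `|x − (2s+1)|H|/n| < ε` with `2D ≤ x₁`, and Lq's margins
stated ONCE at the smaller edge number `N₁ = N₀ − 1` with the window slack `ε + 4` (they pass to `(N₀, ε)` by `lqMargins_mono`; the type margins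
`βN₀+2D+1 ≤ b, d` and `8s ≤ (4+β)(N₀−2D)` at `N₀`, `βN₁ + D ≤ s₁` at `N₁`), plus `q(N₀), q(N₁) ≤ ½` for Lq's ratio
`q(N) = 4((1+η)(η+Q))²/(3β)`, the centring `B^m_1(x) = 0`, a window floor `0 < LB ≤ law_{[n]}(2s+1,1;x)` and the variance floor (V) `cV·law ≤ A^m_1(x)`:
hypothesis `(hBm)` of `gammaProfile_newton_eval_zero_ge_of_centred` holds at `x` with
`ε_B = (m·(Γ(N₁)(2q(N₁) + 3D/s) + 2Γ(N₀)q(N₀)) + D(4/3)^D((2s/n + 4D/n)·a·e^{−(L−2D)²/(4N₁)} + m·e^{−(L−2D)²/(4N₀)})/LB)/√cV`,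
`Γ(N) = 1 + (4(√N+1)/3)·Q(N)` — `sum_abs_fwdDiff_centredFirst_le_of_budgets` ← the tree's `abs_fwdDiff_iter_shellLaw_le_of_hyps` (family on `[n]`) and
brick 136 `levelBudget_pin1` (one-pinned family, window moved by `window_pin1`). [cite: RollinRoss2010, §4.1 Thm 4.2] [cite: Rothvoss2017, §2 (PDF p. 6)]
[cite: Boole2009, Ch. II Art. 10 Ex. 3 eq. (8) (PDF pp. 34–35)] -/
theorem sum_abs_fwdDiff_centredFirst_le (M : PMatch n) (H : Finset (Fin n)) {a₁ b d N₀ N₁ s s₁ D x x₁ : ℕ}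
    (hN01 : N₁ + 1 = N₀) (hs₁ : s₁ + 1 = s) (hx₁ : x₁ + 2 = x)
    (ha : (reps M.2.partner (vAA M.2.partner univ H)).card = a₁ + 1)
    (hb : (reps M.2.partner (vBH M.2.partner univ H ∪ vBN M.2.partner univ H)).card = b)
    (hd : (reps M.2.partner (vDD M.2.partner univ H)).card = d) (hN : a₁ + 1 + b + d = N₀) (hn : n = 2 * N₀)
    {β : ℝ} (hβ : 0 < β) (hβ1 : β ≤ 1 / 4) (hDN : 16 * D + 16 ≤ N₁)
    (hbβ : β * N₀ + 2 * D + 1 ≤ b) (hdβ : β * N₀ + 2 * D + 1 ≤ d)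
    (hs : β * N₁ + D ≤ s₁) (hs' : 8 * (s : ℝ) ≤ (4 + β) * ((N₀ : ℝ) - 2 * D)) (hDs : D ≤ s₁) (hsn : 2 * s + 2 * D + 2 ≤ n)
    {ε : ℝ} (hxε : |(x : ℝ) - (2 * (s : ℝ) + 1) * H.card / n| < ε) (hxD : 2 * D ≤ x₁)
    {L : ℝ} (h2D : 2 * (D : ℝ) ≤ L) (hLN : 2 * L ≤ N₁)
    (h1 : L + D + (ε + 4 + 14 * D + 1) ≤ β ^ 2 * N₁)
    (h2 : L + D + (ε + 4 + 14 * D + 1) + 3 ≤ β * ((N₁ : ℝ) - 2 * D) / 8)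
    (h3 : 2 * (L + D + 1) ≤ (β ^ 2 / 8) ^ 2 * (β * ((N₁ : ℝ) - 2 * D)))
    (h4 : 4 ≤ β * ((N₁ : ℝ) - 2 * D))
    (h5 : (D : ℝ) * (1 + 8 * (L + D + 1) / ((β ^ 2 / 8) ^ 4 * (β * ((N₁ : ℝ) - 2 * D)))) ≤
      (β ^ 2 / 8) ^ 4 * (β * ((N₁ : ℝ) - 2 * D)))
    (hqN₀ : (4 * ((1 + 8 * (L + D + 1) / ((β ^ 2 / 8) ^ 4 * (β * ((N₀ : ℝ) - 2 * D)))) *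
          (8 * (L + D + 1) / ((β ^ 2 / 8) ^ 4 * (β * ((N₀ : ℝ) - 2 * D))) +
            2 * Real.sqrt 192 * Real.sqrt (2 * (2 * (D : ℝ) + 1) * (1 + 8 * (L + D + 1) / ((β ^ 2 / 8) ^ 4 * (β * ((N₀ : ℝ) - 2 * D)))) /
            ((β ^ 2 / 8) ^ 4 * (β * ((N₀ : ℝ) - 2 * D)))))) ^ 2 / (3 * β)) ≤ 1 / 2)
    (hqN₁ : (4 * ((1 + 8 * (L + D + 1) / ((β ^ 2 / 8) ^ 4 * (β * ((N₁ : ℝ) - 2 * D)))) *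
          (8 * (L + D + 1) / ((β ^ 2 / 8) ^ 4 * (β * ((N₁ : ℝ) - 2 * D))) +
            2 * Real.sqrt 192 * Real.sqrt (2 * (2 * (D : ℝ) + 1) * (1 + 8 * (L + D + 1) / ((β ^ 2 / 8) ^ 4 * (β * ((N₁ : ℝ) - 2 * D)))) /
            ((β ^ 2 / 8) ^ 4 * (β * ((N₁ : ℝ) - 2 * D)))))) ^ 2 / (3 * β)) ≤ 1 / 2)
    (m : ℝ)
    (hcentre : ((∑ U ∈ ((shell M.2.partner (2 * s + 1) 1).filter fun U => ((U ∩ H).card : ℤ) = x),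
          (((((reps M.2.partner (vAA M.2.partner univ H)).filter fun v => v ∈ U ∧ M.2.partner v ∈ U).card : ℕ) : ℝ) - m)) /
          ((shell M.2.partner (2 * s + 1) 1).card : ℝ)) = 0)
    {LB cV : ℝ} (hLB0 : 0 < LB) (hLB : LB ≤ shellLaw M.2.partner univ H (2 * s + 1) 1 x) (hcV : 0 < cV)
    (hV : cV * shellLaw M.2.partner univ H (2 * s + 1) 1 x ≤
      ((∑ U ∈ ((shell M.2.partner (2 * s + 1) 1).filter fun U => ((U ∩ H).card : ℤ) = x),
          (((((reps M.2.partner (vAA M.2.partner univ H)).filter fun v => v ∈ U ∧ M.2.partner v ∈ U).card : ℕ) : ℝ) - m) ^ 2) /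
          ((shell M.2.partner (2 * s + 1) 1).card : ℝ))) :
    ∑ k ∈ Ico 1 (D + 1), (((2 * k).choose k : ℕ) : ℝ) / (4 : ℝ) ^ k *
        |(fwdDiff (1 : ℕ))^[k] (fun j => ((∑ U ∈ ((shell M.2.partner (2 * s + 1) (2 * j + 1)).filter fun U => ((U ∩ H).card : ℤ) = x),
          (((((reps M.2.partner (vAA M.2.partner univ H)).filter fun v => v ∈ U ∧ M.2.partner v ∈ U).card : ℕ) : ℝ) - m)) /
          ((shell M.2.partner (2 * s + 1) (2 * j + 1)).card : ℝ))) 0| ≤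
      (m * ((1 + 4 * (Real.sqrt N₁ + 1) / 3 *
          (2 * Real.sqrt 192 * Real.sqrt (2 * (2 * (D : ℝ) + 1) * (1 + 8 * (L + D + 1) / ((β ^ 2 / 8) ^ 4 * (β * ((N₁ : ℝ) - 2 * D)))) /
            ((β ^ 2 / 8) ^ 4 * (β * ((N₁ : ℝ) - 2 * D)))))) * (2 * (4 * ((1 + 8 * (L + D + 1) / ((β ^ 2 / 8) ^ 4 * (β * ((N₁ : ℝ) - 2 * D)))) *
          (8 * (L + D + 1) / ((β ^ 2 / 8) ^ 4 * (β * ((N₁ : ℝ) - 2 * D))) +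
            2 * Real.sqrt 192 * Real.sqrt (2 * (2 * (D : ℝ) + 1) * (1 + 8 * (L + D + 1) / ((β ^ 2 / 8) ^ 4 * (β * ((N₁ : ℝ) - 2 * D)))) /
            ((β ^ 2 / 8) ^ 4 * (β * ((N₁ : ℝ) - 2 * D)))))) ^ 2 / (3 * β)) + 3 * D / s) + 2 * (1 + 4 * (Real.sqrt N₀ + 1) / 3 *
          (2 * Real.sqrt 192 * Real.sqrt (2 * (2 * (D : ℝ) + 1) * (1 + 8 * (L + D + 1) / ((β ^ 2 / 8) ^ 4 * (β * ((N₀ : ℝ) - 2 * D)))) /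
            ((β ^ 2 / 8) ^ 4 * (β * ((N₀ : ℝ) - 2 * D)))))) * (4 * ((1 + 8 * (L + D + 1) / ((β ^ 2 / 8) ^ 4 * (β * ((N₀ : ℝ) - 2 * D)))) *
          (8 * (L + D + 1) / ((β ^ 2 / 8) ^ 4 * (β * ((N₀ : ℝ) - 2 * D))) +
            2 * Real.sqrt 192 * Real.sqrt (2 * (2 * (D : ℝ) + 1) * (1 + 8 * (L + D + 1) / ((β ^ 2 / 8) ^ 4 * (β * ((N₀ : ℝ) - 2 * D)))) /
            ((β ^ 2 / 8) ^ 4 * (β * ((N₀ : ℝ) - 2 * D)))))) ^ 2 / (3 * β))) +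
          (D : ℝ) * (4 / 3 : ℝ) ^ D * ((2 * (s : ℝ) / n + 4 * D / n) * ((reps M.2.partner (vAA M.2.partner univ H)).card * Real.exp (-((L - 2 * D) ^ 2 / (4 * N₁)))) + m * Real.exp (-((L - 2 * D) ^ 2 / (4 * N₀)))) / LB) /
        Real.sqrt cV *
      Real.sqrt (((∑ U ∈ ((shell M.2.partner (2 * s + 1) 1).filter fun U => ((U ∩ H).card : ℤ) = x),
          (((((reps M.2.partner (vAA M.2.partner univ H)).filter fun v => v ∈ U ∧ M.2.partner v ∈ U).card : ℕ) : ℝ) - m) ^ 2) /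
          ((shell M.2.partner (2 * s + 1) 1).card : ℝ)) * shellLaw M.2.partner univ H (2 * s + 1) 1 x) := by
  -- integer bookkeeping
  have hN0r : (N₀ : ℝ) = N₁ + 1 := by rw [← hN01]; push_cast; ring
  have hsr : (s : ℝ) = s₁ + 1 := by rw [← hs₁]; push_cast; ring
  have hD0 : (0 : ℝ) ≤ D := Nat.cast_nonneg _
  have hs₁0 : (0 : ℝ) ≤ s₁ := Nat.cast_nonneg s₁
  have hN1N0 : (N₁ : ℝ) ≤ N₀ := by rw [hN0r]; linarith only
  have hN16 : (16 : ℝ) ≤ N₁ := by exact_mod_cast (show 16 ≤ N₁ by omega)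
  have hnr : (n : ℝ) = 2 * (N₀ : ℝ) := by rw [hn]; push_cast; ring
  have hsn' : 2 * (s : ℝ) + 2 * D + 2 ≤ n := by exact_mod_cast hsn
  -- Lq's margins at `N₀` (monotone in the edge number) and with the slack `ε ≤ ε + 4`
  obtain ⟨hLN₀, h1₀, h2₀, h3₀, h4₀, h5₀⟩ := lqMargins_mono (ε := ε + 4) hβ h2D hN1N0 hLN h1 h2 h3 h4 h5
  have h1₀' : L + D + (ε + 14 * D + 1) ≤ β ^ 2 * N₀ := by linarith only [h1₀]
  have h2₀' : L + D + (ε + 14 * D + 1) + 3 ≤ β * ((N₀ : ℝ) - 2 * D) / 8 := by linarith only [h2₀]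
  have hDN₀ : 16 * D + 16 ≤ N₀ := by omega
  have hs₀ : β * N₀ + D ≤ s := by
    have e : β * (N₀ : ℝ) = β * N₁ + β := by rw [hN0r]; ring
    rw [e, hsr]; linarith only [hs, hβ1]
  have hne₀ : ∀ k, k ≤ D → (shellIn M.2.partner univ (2 * s + 1) (1 + 2 * k)).Nonempty := by
    intro k hk
    rw [shellIn_univ]
    exact shell_partner_nonempty M ⟨s, by ring⟩ ⟨k, by ring⟩ (by omega) (by omega)
  have hxD₀ : 2 * D ≤ x := by omega
  -- the one-pinned family's integer data, margins at `N₁`, and the moved window (`window_pin1`)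
  have hN₁' : a₁ + b + d = N₁ := by omega
  have hn₁ : n - 2 = 2 * N₁ := by omega
  have hβN : β * N₁ ≤ β * N₀ := mul_le_mul_of_nonneg_left hN1N0 hβ.le
  have hbβ₁ : β * N₁ + 2 * D + 1 ≤ b := by linarith only [hβN, hbβ]
  have hdβ₁ : β * N₁ + 2 * D + 1 ≤ d := by linarith only [hβN, hdβ]
  have hs''₁ : 8 * (s₁ : ℝ) ≤ (4 + β) * ((N₁ : ℝ) - 2 * D) := by
    have e1 : 8 * (s₁ : ℝ) = 8 * s - 8 := by rw [hsr]; ring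
    have e2 : (4 + β) * ((N₁ : ℝ) - 2 * D) = (4 + β) * ((N₀ : ℝ) - 2 * D) - (4 + β) := by rw [hN0r]; ring
    rw [e1, e2]; linarith only [hs', hβ1]
  have htypes := card_eq_two_mul_add_of_types (partner_partner M) (partner_ne M) H
  rw [ha, hb] at htypes
  have hHge : 2 ≤ H.card := by omega
  have hHcard : (H.card : ℝ) = 2 * ((a₁ : ℝ) + 1) + b := by rw [htypes]; push_cast; ring
  have habd : ((a₁ : ℝ) + b + d) = N₁ := by exact_mod_cast hN₁'
  have hxε₁ : |(x₁ : ℝ) - (2 * (s₁ : ℝ) + 1) * ((H.card - 2 : ℕ) : ℝ) / ((n - 2 : ℕ) : ℝ)| < ε + 4 := by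
    have hx' : |(x : ℝ) - (2 * (s : ℝ) + 1) * (H.card : ℝ) / (2 * (N₀ : ℝ))| < ε := by rw [← hnr]; exact hxε
    have hw := window_pin1 (P := (H.card : ℝ)) (by rw [hN0r]; linarith only [hN16]) (by exact_mod_cast hHge)
      (by rw [hHcard, hN0r]; linarith only [habd, (Nat.cast_nonneg d : (0 : ℝ) ≤ d)]) (by rw [hsr]; linarith only [hs₁0])
      (by rw [← hnr]; linarith only [hsn', hD0]) hx'
    have e : (x₁ : ℝ) - (2 * (s₁ : ℝ) + 1) * ((H.card - 2 : ℕ) : ℝ) / ((n - 2 : ℕ) : ℝ) =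
        (x : ℝ) - 2 - (2 * (s : ℝ) - 1) * ((H.card : ℝ) - 2) / (2 * ((N₀ : ℝ) - 1)) := by
      have hxr : (x : ℝ) = x₁ + 2 := by rw [← hx₁]; push_cast; ring
      rw [Nat.cast_sub hHge, Nat.cast_sub (by omega : 2 ≤ n), hxr, hsr, hnr]
      push_cast; ring
    rw [e]; exact hw
  -- family on `[n]`: Lq; the one-pinned family: brick 136
  have hR₀ := abs_fwdDiff_iter_shellLaw_le_of_hyps (partner_partner M) (partner_ne M) H ha hb hd hN hn hβ hβ1 hDN₀ hbβ hdβ hs₀ hs'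
    hne₀ hxε hxD₀ h2D hLN₀ h1₀' h2₀' h3₀ h4₀ h5₀
  have hR₁ := levelBudget_pin1 M H ha hb hd hN₁' hn₁ hβ hβ1 hDN hbβ₁ hdβ₁ hs hs''₁ (by omega) (by omega) hxε₁ hxD h2D hLN h1 h2 h3 h4 h5
  -- §3
  refine sum_abs_fwdDiff_centredFirst_le_of_budgets M H hs₁ hx₁ (by omega) hsn m ?_ ?_ hqN₀ (Real.exp_nonneg _) ?_ ?_ hqN₁
    (Real.exp_nonneg _) hR₀ hR₁ hcentre hLB0 hLB hcV hV
  · exact le_add_of_nonneg_right (by positivity)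
  · exact div_nonneg (mul_nonneg (by norm_num) (sq_nonneg _)) (by positivity)
  · exact le_add_of_nonneg_right (by positivity)
  · exact div_nonneg (mul_nonneg (by norm_num) (sq_nonneg _)) (by positivity)

/-! ### §3 (v2) The canonical centring `m(x) = E_1[n_A ∣ X = x]`: brick 130's `hcentre` holds for it at EVERY point -/

/-- **The conditional mean centres the first moment.** With `m(x) = (Σ_{U ∈ Shell_1, X(U)=x} n_A(U)) / #{U ∈ Shell_1 : X(U) = x}` (junk value `0` on an
empty fibre), brick 130's hypothesis `hcentre` — `(Σ_{U ∈ Shell_1, X(U) = x} (n_A(U) − m(x))) / |Shell_1| = 0` — holds at EVERY `x ∈ ℤ` (empty fibre: empty sum).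
So the assembler may take `mf := m` on the whole window with no side condition. [cite: Rothvoss2017, §2 (PDF p. 6)] -/
theorem hcentre_condMean (M : PMatch n) (H : Finset (Fin n)) (t : ℕ) (x : ℤ) :
    ((∑ U ∈ ((shell M.2.partner t 1).filter fun U => ((U ∩ H).card : ℤ) = x),
        (((((reps M.2.partner (vAA M.2.partner univ H)).filter fun v => v ∈ U ∧ M.2.partner v ∈ U).card : ℕ) : ℝ) -
          (∑ U' ∈ ((shell M.2.partner t 1).filter fun U => ((U ∩ H).card : ℤ) = x),
              ((((reps M.2.partner (vAA M.2.partner univ H)).filter fun v => v ∈ U' ∧ M.2.partner v ∈ U').card : ℕ) : ℝ)) /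
            ((((shell M.2.partner t 1).filter fun U => ((U ∩ H).card : ℤ) = x).card : ℕ) : ℝ))) /
        ((shell M.2.partner t 1).card : ℝ)) = 0 := by
  refine div_eq_zero_iff.2 (Or.inl ?_)
  rw [sum_sub_distrib, sum_const, nsmul_eq_mul]
  rcases eq_or_ne (((((shell M.2.partner t 1).filter fun U => ((U ∩ H).card : ℤ) = x).card : ℕ) : ℝ)) 0 with h | h
  · have h0 : ((shell M.2.partner t 1).filter fun U => ((U ∩ H).card : ℤ) = x) = ∅ := by
      rw [← card_eq_zero]; exact_mod_cast h
    rw [h0]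
    simp
  · field_simp
    ring

/-- **The conditional mean lies in `[0, a]`**: `0 ≤ m(x) ≤ a = |reps(vAA)|` (`0 ≤ n_A ≤ a` pointwise; the junk value `0` on an empty fibre also qualifies).
[cite: Rothvoss2017, §2 (PDF p. 6)] -/
theorem condMean_mem_Icc (M : PMatch n) (H : Finset (Fin n)) (t : ℕ) (x : ℤ) :
    0 ≤ (∑ U' ∈ ((shell M.2.partner t 1).filter fun U => ((U ∩ H).card : ℤ) = x),
          ((((reps M.2.partner (vAA M.2.partner univ H)).filter fun v => v ∈ U' ∧ M.2.partner v ∈ U').card : ℕ) : ℝ)) /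
        ((((shell M.2.partner t 1).filter fun U => ((U ∩ H).card : ℤ) = x).card : ℕ) : ℝ) ∧
    (∑ U' ∈ ((shell M.2.partner t 1).filter fun U => ((U ∩ H).card : ℤ) = x),
          ((((reps M.2.partner (vAA M.2.partner univ H)).filter fun v => v ∈ U' ∧ M.2.partner v ∈ U').card : ℕ) : ℝ)) /
        ((((shell M.2.partner t 1).filter fun U => ((U ∩ H).card : ℤ) = x).card : ℕ) : ℝ) ≤
      (reps M.2.partner (vAA M.2.partner univ H)).card := by
  refine ⟨by positivity, ?_⟩
  rcases eq_or_ne (((((shell M.2.partner t 1).filter fun U => ((U ∩ H).card : ℤ) = x).card : ℕ) : ℝ)) 0 with h | h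
  · rw [h, div_zero]; exact Nat.cast_nonneg _
  · rw [div_le_iff₀ (lt_of_le_of_ne (Nat.cast_nonneg _) (Ne.symm h))]
    have hle : ∑ U' ∈ ((shell M.2.partner t 1).filter fun U => ((U ∩ H).card : ℤ) = x),
        ((((reps M.2.partner (vAA M.2.partner univ H)).filter fun v => v ∈ U' ∧ M.2.partner v ∈ U').card : ℕ) : ℝ) ≤
        ∑ U' ∈ ((shell M.2.partner t 1).filter fun U => ((U ∩ H).card : ℤ) = x), ((reps M.2.partner (vAA M.2.partner univ H)).card : ℝ) :=
      sum_le_sum fun U _ => by exact_mod_cast card_filter_le _ _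
    rw [sum_const, nsmul_eq_mul] at hle
    linarith

end Summit.PneNP.PneNP.Theorems.ChebyshevTracialDesignGammaDirectionFirstMomentTurnkey

end
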